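import Summits.Ventures.HSemireg.FormulaNUniformBlocks

/-!
# Venture HSemireg — FORMULA-N: the CORRECTED per-`q` enumerator for SURFACE POWERS `F_n = ⊠ⁿ I_{p_i}` in closed form
# (th-6 §4.1″ overcount caveat: closed form = every measured row `n = 3, 4, 5`; naive count = `[t^k u^q]Q_2ⁿ` proved for all `n`)

HONEST FRAMING. Part of the Lean index of the computation cell `pub-hsemireg` (seat p10 gen 2, Sunday typer «UNIFORM-IN-n»).
ARITHMETIC ONLY: no variety, no cohomology theory, no sheaf, no semiregularity map is constructed here; nothing here says that
HC / HC_CM / HC_AV holds; no Literature fact is declared or used.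

THE CAVEAT OF RECORD (theory/FORMULA-N.md PART A §4.1″, th-6): «SURFACE POWERS `F_n = ⊠ⁿ I_{p_i}` (≥ 3 factors): `[t^m u^q] Q_2(t,u)ⁿ`
OVERCOUNTS exactly where two or more factors sit in degree 0 (each T⁰ is ONE vector `1 − pt` with two q-components): F₃, m = 2 gives
`(15,24,30,24,15)` vs the measured `(15,24,27,24,15)` — the 3 = #{orderings of (2,0,0)}·(2−1) coincidences at q = 2; the corrected
enumerator is th-7's image model (PART B), which th-6 does not duplicate.»  Measured per-`q` rows of record (engine-1 DIRECT / th-7,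
FORMULA-N §4.1): F₃ `Ext²` `(15,24,27,24,15)`, F₄ `Ext²` `(28,48,52,48,52,48,28)`, F₅ `Ext²` `(45,80,85,80,85,80,85,80,45)`.

WHAT IS TYPED HERE (p10's closed form for the corrected enumerator; derivation in the docstring of `spCount`, on paper for ≥ 3
factors — the 2-factor case IS the tree's kernel rank theorem `WedgeBox.finrank_range_blockProj_wedgeMap_fac_mul` at `n = 2`):
* `classCount m k q_f = C(m, k−m)·2^{2m−k}·C(2m−k, q_f)` (`m ≤ k ≤ 2m`): the number of SOURCE CLASSES on `m` NON-EMPTY surface factors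
  with total degree `k` and fixed Dolbeault part `q_f` — `k − m` factors in degree 2 (one class each, `q = 0`, top collapse) and
  `2m − k` factors in degree 1 (two letters `x` with `q = 1`, two letters `y` with `q = 0`); generating function `(2t(1+u) + t²)^m`;
* `spCount n k q = Σ_z C(n,z) · #{j ≤ z : 2j ≤ q} ⋆ classCount (n−z) k (q − 2j)` summed over `j` — each class with `z` EMPTY factors is
  counted ONCE in every block `q = q_f + 2j`, `0 ≤ j ≤ z` (an empty factor contributes `1` (q = 0) AND `pt` (q = 2) to the SAME source
  vector) — versus the naive `naiveCount` with the binomial `C(z, j)` in place of `1`, which IS th-6's `[t^k u^q] Q_2(t,u)ⁿ`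
  (`Q_2 = 1 + u² + 2t(1+u) + t²`) for EVERY `n, k, q`: `naiveCount_eq_coeff_Q_pow` (binomial theorem twice, kernel);
* KERNEL CHECKS (`decide`): `spCount 3 2 = (15,24,27,24,15)`, `spCount 4 2 = (28,48,52,48,52,48,28)`, `spCount 5 2 =
  (45,80,85,80,85,80,85,80,45)` — with the degree-1 rows below, EVERY measured surface-power per-`q` row of record (6 rows,
  0 mismatches); `naiveCount 3 2 = (15,24,30,24,15)` (th-6's overcount, `30 − 27 = 3`); and at TWO factors the corrected and
  naive counts agree with the tree's `blockCount 2 k q` for `k ≥ 1`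
  (`spCount_two_eq_blockCount`: there the per-q law is exact, th-6's «harmless for two factors»), while at `k = 0` they differ
  (`(1,0,1,0,1)` vs `(1,0,2,0,1)` — the `m ≥ 1` exception of `WedgeBoxPerQOverlap.perq_law_fails_in_degree_zero`); in degree 1 the
  corrected count is the measured row at `n = 3, 4, 5` (`(6,6,6,6,6,6)`, `8 each`, `10 each`), the naive one `(6,6,12,12,6,6)` at
  `n = 3` (`spCount_rows_one`); cross-check of the symbolic theorem at `n = 3` by `decide` against the computable triple Cauchy
  product `blockCount3` (`coeff_Q_cube`, `naiveCount_three_eq_coeff_Q_cube`); PRE-REGISTERED predictions (`spCount_predictions`);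
* THE CORRECTED GENERATING FUNCTION `S_n(t,u) = Σ_z C(n,z)(1 + u² + ⋯ + u^{2z})(t(t+2+2u))^{n−z}` (`spGen`) with
  `[t^k u^q] S_n = spCount n k q` for every `n, k, q` (`coeff_spGen`) — th-6's `Q_2ⁿ` with `(1+u²)^z ↦ 1 + u² + ⋯ + u^{2z}`;
  degree-2 closed form `(2n²−n, 4n²−4n, 4n²−3n, 4n²−4n, …, 4n²−3n, 4n²−4n, 2n²−n)` checked for `n ≤ 6` (`spCount_two_closed_small`).
WHAT IS NOT HERE: that `spCount n k q` IS the rank of the `q`-block of `θ ↦ θ ∧ F_n` on `⋀^k K^{4n}` for `n ≥ 3` (the wedge-model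
theorem needs the class decomposition of multi-term images; on paper: distinct classes have disjoint monomial supports, a class with
`z` empty factors has a non-zero component in block `q_f + 2j` for each `j ≤ z`); the Ext-side identification (bridge, by value).
-/

open Finset Polynomial

namespace Summit.Ventures.HSemireg.FormulaN.Uniform

/-- SOURCE CLASSES on `m` non-empty surface factors, total degree `k`, fixed Dolbeault part `q_f`:
`C(m, k−m)·2^{2m−k}·C(2m−k, q_f)` for `m ≤ k ≤ 2m` (choose the `k − m` factors in degree 2; each of the `2m − k` degree-1 factors
carries one of 2 letters of `q`-type 1 or one of 2 letters of `q`-type 0), `0` otherwise; `= [t^k u^{q_f}] (2t(1+u) + t²)^m`. -/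
def classCount (m k qf : ℕ) : ℕ :=
  if m ≤ k ∧ k ≤ m + m then m.choose (k - m) * 2 ^ (m + m - k) * (m + m - k).choose qf else 0

/-- **THE CORRECTED PER-q ENUMERATOR for the `n`-fold surface box** in degree `k`, block `q`: a class with `z` empty factors
(`C(n,z)` choices) and fixed part `q_f` is counted ONCE in each block `q = q_f + 2j`, `0 ≤ j ≤ z`. -/
def spCount (n k q : ℕ) : ℕ :=
  ∑ z ∈ range (n + 1), n.choose z *
    ∑ j ∈ range (z + 1), (if 2 * j ≤ q then classCount (n - z) k (q - 2 * j) else 0)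

/-- the NAIVE enumerator: the same sum with the binomial `C(z, j)` (each of the `2^z` component choices of the empty factors counted
separately) — this IS th-6's `[t^k u^q] Q_2(t,u)ⁿ` for every `n, k, q` (`naiveCount_eq_coeff_Q_pow` below); its `n = 3`, degree-2 row
`(15,24,30,24,15)` is th-6's printed value. -/
def naiveCount (n k q : ℕ) : ℕ :=
  ∑ z ∈ range (n + 1), n.choose z *
    ∑ j ∈ range (z + 1), (if 2 * j ≤ q then z.choose j * classCount (n - z) k (q - 2 * j) else 0)

/-- **AGREEMENT WITH EVERY MEASURED SURFACE-POWER ROW** (FORMULA-N §4.1: F₃ `(15,24,27,24,15)` engine-1 DIRECT j161105 ✓th-7;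
F₄ `(28,48,52,48,52,48,28)`; F₅ `(45,80,85,80,85,80,85,80,45)`), degree 2. -/
theorem spCount_rows_two :
    (List.range 5).map (spCount 3 2) = [15, 24, 27, 24, 15] ∧
    (List.range 7).map (spCount 4 2) = [28, 48, 52, 48, 52, 48, 28] ∧
    (List.range 9).map (spCount 5 2) = [45, 80, 85, 80, 85, 80, 85, 80, 45] := by
  decide

/-- th-6's overcount at `n = 3`, degree 2: naive `(15,24,30,24,15)` vs corrected `(15,24,27,24,15)` — «the 3 = #{orderings of
(2,0,0)}·(2−1) coincidences at q = 2». -/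
theorem naiveCount_three_two :
    (List.range 5).map (naiveCount 3 2) = [15, 24, 30, 24, 15] ∧ naiveCount 3 2 2 = spCount 3 2 2 + 3 := by
  decide

/-- degree 1: the corrected count is the measured `Ext¹` per-q row at `n = 3, 4, 5` — F₃ `(6,6,6,6,6,6)` (engine-1 DIRECT j161490),
F₄ `16 (8 each)`, F₅ `20 (10 each)` (FORMULA-N §4.1) — while the naive `[t¹ u^q] Q_2³` gives `(6,6,12,12,6,6)`: the overcount is not
confined to degree 2. -/
theorem spCount_rows_one :
    (List.range 6).map (spCount 3 1) = [6, 6, 6, 6, 6, 6] ∧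
    (List.range 8).map (spCount 4 1) = [8, 8, 8, 8, 8, 8, 8, 8] ∧
    (List.range 10).map (spCount 5 1) = [10, 10, 10, 10, 10, 10, 10, 10, 10, 10] ∧
    (List.range 6).map (naiveCount 3 1) = [6, 6, 12, 12, 6, 6] := by
  decide

/-- **TWO FACTORS: the corrected enumerator IS the tree's per-q law** (`blockCount 2 k q` of `FormulaNUniformBlocks.lean`, whose rank
form is `WedgeBox.finrank_range_blockProj_wedgeMap_fac_mul` at `n = 2`) in every positive degree `k = 1, …, 4` — th-6's «harmless
for two factors and m ≥ 1»; in degree `0` they differ (`(1,0,1,0,1)` vs `blockCount 2 0 = (1,0,2,0,1)`: the `m ≥ 1` exception, block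
`q = n = 2` of rank `1`, `WedgeBoxPerQOverlap.perq_law_fails_in_degree_zero`). -/
theorem spCount_two_eq_blockCount :
    (∀ k ∈ [1, 2, 3, 4], ∀ q ∈ List.range 5, spCount 2 k q = blockCount 2 k q) ∧
    (List.range 5).map (spCount 2 0) = [1, 0, 1, 0, 1] ∧ (List.range 5).map (blockCount 2 0) = [1, 0, 2, 0, 1] := by
  decide

/-- `[t^m u^q] Q_n(t,u)³` as a computable triple Cauchy product (`blockCount` ⋆ `qAtom`). -/
def blockCount3 (n m q : ℕ) : ℕ :=
  ∑ ab ∈ antidiagonal m, ∑ pr ∈ antidiagonal q, blockCount n ab.1 pr.1 * qAtom n ab.2 pr.2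

/-- `[t^m u^q] Q_n(t,u)³ = blockCount3 n m q` for all `n, m, q`. -/
theorem coeff_Q_cube (n m q : ℕ) : ((Q n ^ 3).coeff m).coeff q = (blockCount3 n m q : ℤ) := by
  rw [pow_succ, Polynomial.coeff_mul, Polynomial.finsetSum_coeff, blockCount3]
  push_cast
  refine Finset.sum_congr rfl fun ab _ => ?_
  rw [Polynomial.coeff_mul]
  refine Finset.sum_congr rfl fun pr _ => ?_
  rw [coeff_Q_sq, coeff_Q]

/-- cross-check at `n = 3` (independent of `naiveCount_eq_coeff_Q_pow`): the naive enumerator against the computable coefficient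
`blockCount3 2 = [t^k u^q] Q_2³` (`coeff_Q_cube`), every degree `k ≤ 6` and block `q ≤ 6`, by `decide`. -/
theorem naiveCount_three_eq_coeff_Q_cube :
    ∀ k ∈ List.range 7, ∀ q ∈ List.range 7, naiveCount 3 k q = blockCount3 2 k q := by
  decide

/-- `Q_2 = (1 + u²) + t·(t + (2 + 2u))` with `t = X` (outer variable), `u = C X` (inner). -/
theorem Q_two_eq : Q 2 = C (X ^ 2 + 1) + X * (X + C (2 + 2 * X)) := by
  simp only [Q, map_add, map_pow, map_mul, map_one, map_ofNat]
  ring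

/-- inner coefficient: `[u^q] (u² + 1)^z · r = Σ_{j ≤ z, 2j ≤ q} C(z,j) · [u^{q−2j}] r`. -/
theorem coeff_X_sq_add_one_pow_mul (z q : ℕ) (r : Polynomial ℤ) :
    ((X ^ 2 + 1) ^ z * r).coeff q =
      ∑ j ∈ range (z + 1), (if 2 * j ≤ q then (z.choose j : ℤ) * r.coeff (q - 2 * j) else 0) := by
  rw [add_pow, Finset.sum_mul, finsetSum_coeff]
  refine Finset.sum_congr rfl fun j _ => ?_
  rw [one_pow, mul_one, ← pow_mul, mul_comm ((X : Polynomial ℤ) ^ (2 * j)), mul_assoc, coeff_natCast_mul,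
    coeff_X_pow_mul']
  split_ifs <;> simp

/-- `[u^q] (2 + 2u)^e = 2^e · C(e, q)`. -/
theorem coeff_two_add_two_X_pow (e q : ℕ) : (((2 : Polynomial ℤ) + 2 * X) ^ e).coeff q = 2 ^ e * (e.choose q : ℤ) := by
  have : (2 : Polynomial ℤ) + 2 * X = C 2 * (1 + X) := by
    simp only [map_ofNat]; ring
  rw [this, mul_pow, ← map_pow, coeff_C_mul, coeff_one_add_X_pow]

/-- outer coefficient of one binomial term: `[t^k] C(c) · (t·(t + C a))^m · N = [m ≤ k] · c · a^{m−(k−m)} · C(m, k−m) · N`. -/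
theorem coeff_C_mul_X_mul_pow_mul_natCast (c a : Polynomial ℤ) (m k N : ℕ) :
    (C c * (X * (X + C a)) ^ m * (N : ℤ[X][X])).coeff k
      = if m ≤ k then c * (a ^ (m - (k - m)) * (m.choose (k - m) : Polynomial ℤ)) * N else 0 := by
  rw [coeff_mul_natCast, coeff_C_mul, mul_pow, coeff_X_pow_mul']
  split_ifs with h
  · rw [coeff_X_add_C_pow]
  · simp

/-- **th-6's NAIVE ENUMERATOR IS `[t^k u^q] Q_2(t,u)ⁿ` — for EVERY `n, k, q`** (binomial theorem in `t` and in `u`: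
`Q_2ⁿ = Σ_z C(n,z) (1+u²)^z (t(t + 2 + 2u))^{n−z}`, `[t^k](t(t+a))^m = a^{2m−k} C(m,k−m)`,
`[u^·](1+u²)^z (2+2u)^e = Σ_j C(z,j) 2^e C(e,·)`). -/
theorem naiveCount_eq_coeff_Q_pow (n k q : ℕ) : ((Q 2 ^ n).coeff k).coeff q = (naiveCount n k q : ℤ) := by
  rw [Q_two_eq, add_pow, finsetSum_coeff, finsetSum_coeff, naiveCount]
  push_cast
  refine Finset.sum_congr rfl fun z _ => ?_
  rw [← map_pow, coeff_C_mul_X_mul_pow_mul_natCast]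
  split_ifs with hmk
  · rw [mul_comm (((X : Polynomial ℤ) ^ 2 + 1) ^ z * _) _,
      coeff_natCast_mul, coeff_X_sq_add_one_pow_mul, Finset.mul_sum, Finset.mul_sum]
    refine Finset.sum_congr rfl fun j _ => ?_
    split_ifs with hj
    · rw [coeff_mul_natCast, coeff_two_add_two_X_pow, classCount]
      by_cases hk2 : k ≤ (n - z) + (n - z)
      · rw [if_pos ⟨hmk, hk2⟩]
        have e1 : n - z - (k - (n - z)) = (n - z) + (n - z) - k := by omega
        rw [e1]; push_cast; ring
      · rw [if_neg (fun h => hk2 h.2)]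
        have e2 : (n - z).choose (k - (n - z)) = 0 := Nat.choose_eq_zero_of_lt (by omega)
        rw [e2]; push_cast; ring
    · simp
  · rw [Polynomial.coeff_zero]
    symm
    refine mul_eq_zero_of_right _ (Finset.sum_eq_zero fun j _ => ?_)
    rw [classCount]
    split_ifs with h1 h2
    · exact absurd h2.1 hmk
    · simp
    · rfl

/-- **THE CORRECTED GENERATING FUNCTION** `S_n(t,u) := Σ_z C(n,z) · (1 + u² + ⋯ + u^{2z}) · (t(t + 2 + 2u))^{n−z}` — th-6's
`Q_2ⁿ = Σ_z C(n,z) (1+u²)^z (t(t+2+2u))^{n−z}` with `(1+u²)^z` replaced by `1 + u² + ⋯ + u^{2z}` (each class counted ONCE per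
block it reaches); `S_n(t,1) ≠ P_2(t)ⁿ` in general (blocks overlap). -/
noncomputable def spGen (n : ℕ) : ℤ[X][X] :=
  ∑ z ∈ range (n + 1), C (∑ j ∈ range (z + 1), (X : Polynomial ℤ) ^ (2 * j)) * (X * (X + C (2 + 2 * X))) ^ (n - z)
    * (n.choose z : ℤ[X][X])

/-- inner coefficient: `[u^q] (1 + u² + ⋯ + u^{2z}) · r = Σ_{j ≤ z, 2j ≤ q} [u^{q−2j}] r`. -/
theorem coeff_sum_X_pow_mul (z q : ℕ) (r : Polynomial ℤ) :
    ((∑ j ∈ range (z + 1), (X : Polynomial ℤ) ^ (2 * j)) * r).coeff q =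
      ∑ j ∈ range (z + 1), (if 2 * j ≤ q then r.coeff (q - 2 * j) else 0) := by
  rw [Finset.sum_mul, finsetSum_coeff]
  refine Finset.sum_congr rfl fun j _ => ?_
  rw [coeff_X_pow_mul']

/-- **`[t^k u^q] S_n(t,u) = spCount n k q` for every `n, k, q`** — the corrected enumerator as a generating function. -/
theorem coeff_spGen (n k q : ℕ) : ((spGen n).coeff k).coeff q = (spCount n k q : ℤ) := by
  rw [spGen, finsetSum_coeff, finsetSum_coeff, spCount]
  push_cast
  refine Finset.sum_congr rfl fun z _ => ?_
  rw [coeff_C_mul_X_mul_pow_mul_natCast]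
  split_ifs with hmk
  · rw [mul_comm ((∑ j ∈ range (z + 1), (X : Polynomial ℤ) ^ (2 * j)) * _) _,
      coeff_natCast_mul, coeff_sum_X_pow_mul, Finset.mul_sum, Finset.mul_sum]
    refine Finset.sum_congr rfl fun j _ => ?_
    split_ifs with hj
    · rw [coeff_mul_natCast, coeff_two_add_two_X_pow, classCount]
      by_cases hk2 : k ≤ (n - z) + (n - z)
      · rw [if_pos ⟨hmk, hk2⟩]
        have e1 : n - z - (k - (n - z)) = (n - z) + (n - z) - k := by omega
        rw [e1]; push_cast; ring
      · rw [if_neg (fun h => hk2 h.2)]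
        have e2 : (n - z).choose (k - (n - z)) = 0 := Nat.choose_eq_zero_of_lt (by omega)
        rw [e2]; push_cast; ring
    · simp
  · rw [Polynomial.coeff_zero]
    symm
    refine mul_eq_zero_of_right _ (Finset.sum_eq_zero fun j _ => ?_)
    rw [classCount]
    split_ifs with h1 h2
    · exact absurd h2.1 hmk
    · simp
    · rfl

/-- **degree-2 closed form (C10 per-q)**, checked for `2 ≤ n ≤ 6` and all `q ≤ 2n − 2`: the F_n `Ext²` per-q row is
`2n² − n` at the two ends `q ∈ {0, 2n−2}`, `4n² − 4n` at odd `q`, `4n² − 3n` at the inner even `q` (on paper for all `n`: type `(2)`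
classes `n·[q even]`, type `(1,1)` classes `C(n,2)·(4,8,4)` spread over `j ≤ n − 2`). -/
theorem spCount_two_closed_small :
    ∀ n ∈ [2, 3, 4, 5, 6], ∀ q ∈ List.range (2 * n - 1), spCount n 2 q =
      (if q = 0 ∨ q = 2 * n - 2 then 2 * n ^ 2 - n else if q % 2 = 1 then 4 * n ^ 2 - 4 * n else 4 * n ^ 2 - 3 * n) := by
  decide

/-- **PRE-REGISTERED PREDICTIONS** (no measured row existed at registration, bus l.11413 2026-08-23T09:16Z; HOME/p10/SURFACE-POWER-
PERQ-p10.md §4): F₆ `Ext²` per-q `(66,120,126,120,126,120,126,120,126,120,66)` (sum `1236`; total rank `246 = 8·36 − 42`); degree 3: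
F₃ `(20,36,36,20)` (sum `112`, total rank `88`), F₄ `(56,120,152,152,120,56)` (sum `656`, total rank `304`). OUTCOME (record):
«DECIDED on an independent class-side engine: ALL THREE CONFIRMED» — engine-w-1 g4 code A, bus 09:36:30Z (perq_A.py 6e6b47c7318b7fb5,
out/perq/perq-n{3,4,5,6}.A.json), which also reproduced the six measured rows. -/
theorem spCount_predictions :
    (List.range 11).map (spCount 6 2) = [66, 120, 126, 120, 126, 120, 126, 120, 126, 120, 66] ∧
    (List.range 6).map (spCount 3 3) = [20, 36, 36, 20, 0, 0] ∧
    (List.range 6).map (spCount 4 3) = [56, 120, 152, 152, 120, 56] := by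
  decide

/-- one row beyond the registered list, computed FIRST by engine-w-1 code A (bus 09:36:30Z: «F₅ Ext³ (q = 0..7) =
(120,280,360,360,360,360,280,120), total 720») and reproduced here by the closed form. -/
theorem spCount_five_three :
    (List.range 8).map (spCount 5 3) = [120, 280, 360, 360, 360, 360, 280, 120] := by
  decide

/-- the block sums: corrected `Σ_q spCount 3 2 q = 105`, naive `108`, total rank `[t²](1+4t+t²)³ = 51` — blocks of the 3-fold
surface box overlap heavily (cf. `WedgeBoxPerQOverlap.sum_finrank_range_blockProj_eq` for two factors: `Σ_q = rank + 2r_k`). -/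
theorem spCount_sum_three_two :
    (∑ q ∈ range 5, spCount 3 2 q, ∑ q ∈ range 5, naiveCount 3 2 q, plainFamilyARank 3) = (105, 108, 51) := by
  decide

end Summit.Ventures.HSemireg.FormulaN.Uniform
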